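import Mathlib.Logic.Relation
import Literature.Computability.Complexity.SymmetricThresholdPrograms
import HarnessLib

/-!
# Symmetric threshold programs: the reachability (transitive closure) gadget

A reusable GADGET for symmetric threshold programs (`SymProg`, `SymmetricThresholdPrograms.lean`):
reachability along a wire-given edge relation inside a wire-given vertex set — the "connected
components of the switching graph of the current part" step of section-based canonisation
(Corneil–Goldberg sections; route `PneNP/SymmetryBudget`, item `NoHiddenOrder`), and generally the
transitive-closure primitive of fixed-point logics compiled to circuits (Anderson–Dawar 2017, §3).

Data (`SymProg.Reach P V T`): membership wires `mem u`, edge wires `edge u v` (`u v : V`), guarded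
edge gates `e u v = mem u ∧ mem v ∧ edge u v`, and `T` rounds of the linear closure
`r (i+1) u v = r i u v ∨ ∃ w, r i u w ∧ e w v` from `r 0 u v = [u = v] ∧ mem u`.
Writing `Mem`, `Ex` for the membership predicate and the guarded edge relation on input `x`:
* `Reach.sem_r` — `r i u v` carries `Mem u ∧ StepLE Ex i u v` (reachable in at most `i` steps);
* `Reach.stepLE_of_reflTransGen` — if the members are at most `T`, every `Ex`-reachable pair is
  reachable in at most `T` steps (growth of the reachable SET, no paths needed);
* `Reach.sem_r_last_iff` — hence `r T u v` carries `Mem u ∧ Relation.ReflTransGen Ex u v`.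
Gate count `O(T·|V|³)`.

## References
* M. Anderson, A. Dawar, *On symmetric circuits and fixed-point logics*, Theory Comput. Syst. 60
  (2017), §3 (fixed points by unrolling) [AndersonDawar2016].
-/

namespace Literature.Computability.Complexity

open Finset

namespace SymProg

/-! ### Reachability in a bounded number of steps -/

section StepLE

variable {V : Type*} (E : V → V → Prop)

/-- `StepLE E n u v`: `v` is reachable from `u` along `E` in at most `n` steps. [folklore] -/
def StepLE : ℕ → V → V → Prop
  | 0, u, v => u = v
  | n + 1, u, v => StepLE n u v ∨ ∃ w, StepLE n u w ∧ E w v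

/-- Zero steps. [folklore] -/
@[simp] theorem stepLE_zero (u v : V) : StepLE E 0 u v ↔ u = v := Iff.rfl

/-- The recursion. [folklore] -/
theorem stepLE_succ (n : ℕ) (u v : V) :
    StepLE E (n + 1) u v ↔ StepLE E n u v ∨ ∃ w, StepLE E n u w ∧ E w v := Iff.rfl

/-- Monotonicity in the number of steps. [folklore] -/
theorem StepLE.mono {n n' : ℕ} (h : n ≤ n') {u v : V} (huv : StepLE E n u v) : StepLE E n' u v := by
  induction h with
  | refl => exact huv
  | step _ ih => exact Or.inl ih

/-- Bounded reachability is reachability. [folklore] -/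
theorem StepLE.reflTransGen {n : ℕ} {u v : V} (h : StepLE E n u v) : Relation.ReflTransGen E u v := by
  induction n generalizing v with
  | zero => rw [stepLE_zero] at h; subst h; exact Relation.ReflTransGen.refl
  | succ n ih =>
    rcases h with h | ⟨w, hw, hwv⟩
    · exact ih h
    · exact (ih hw).tail hwv

/-- Reachability is bounded reachability for some bound. [folklore] -/
theorem exists_stepLE_of_reflTransGen {u v : V} (h : Relation.ReflTransGen E u v) : ∃ n, StepLE E n u v := by
  induction h with
  | refl => exact ⟨0, rfl⟩
  | tail _ hbc ih => obtain ⟨n, hn⟩ := ih; exact ⟨n + 1, Or.inr ⟨_, hn, hbc⟩⟩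

variable [Fintype V] [DecidableEq V] [DecidableRel E]

/-- `StepLE` is decidable. [folklore] -/
instance StepLE.decidable : ∀ n, DecidableRel (StepLE E n)
  | 0 => fun u v => by rw [stepLE_zero]; infer_instance
  | n + 1 => fun u v => by
    haveI := StepLE.decidable n
    rw [stepLE_succ]; infer_instance

/-- The set of vertices reachable from `u` in at most `n` steps. [folklore] -/
def reachSet (n : ℕ) (u : V) : Finset V := univ.filter fun v => StepLE E n u v

/-- Membership in the reachable set. [folklore] -/
theorem mem_reachSet {n : ℕ} {u v : V} : v ∈ reachSet E n u ↔ StepLE E n u v := by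
  simp [reachSet]

/-- The reachable sets grow. [folklore] -/
theorem reachSet_mono {n n' : ℕ} (h : n ≤ n') (u : V) : reachSet E n u ⊆ reachSet E n' u :=
  fun _ hv => (mem_reachSet E).2 (((mem_reachSet E).1 hv).mono E h)

/-- The successor set is determined by the current set. [folklore] -/
theorem mem_reachSet_succ {n : ℕ} {u v : V} :
    v ∈ reachSet E (n + 1) u ↔ v ∈ reachSet E n u ∨ ∃ w ∈ reachSet E n u, E w v := by
  simp only [mem_reachSet, stepLE_succ]

/-- Once the reachable set stops growing it is stable for ever. [folklore] -/
theorem reachSet_eq_of_stable {n : ℕ} {u : V} (h : reachSet E (n + 1) u = reachSet E n u) :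
    ∀ k, reachSet E (n + k) u = reachSet E n u := by
  intro k
  induction k with
  | zero => rfl
  | succ k ih =>
    rw [← add_assoc]
    ext v
    rw [mem_reachSet_succ, ih]
    constructor
    · intro hv
      rw [← h, mem_reachSet_succ]
      exact hv
    · exact Or.inl

/-- Before stabilisation the reachable set has at least `n + 1` elements. [folklore] -/
theorem card_reachSet_ge (u : V) : ∀ n, n + 1 ≤ (reachSet E n u).card ∨
    ∃ k < n, reachSet E (k + 1) u = reachSet E k u := by
  intro n
  induction n with
  | zero =>
    left
    rw [zero_add, Nat.one_le_iff_ne_zero, Ne, Finset.card_eq_zero, ← Ne, ← Finset.nonempty_iff_ne_empty]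
    exact ⟨u, (mem_reachSet E).2 rfl⟩
  | succ n ih =>
    rcases ih with ih | ⟨k, hk, hstab⟩
    · by_cases hs : reachSet E (n + 1) u = reachSet E n u
      · exact Or.inr ⟨n, Nat.lt_succ_self n, hs⟩
      · left
        have hss : reachSet E n u ⊂ reachSet E (n + 1) u :=
          Finset.ssubset_iff_subset_ne.2 ⟨reachSet_mono E (Nat.le_succ n) u, Ne.symm hs⟩
        have := Finset.card_lt_card hss
        omega
    · exact Or.inr ⟨k, Nat.lt_succ_of_lt hk, hstab⟩

/-- **Short reachability.** If every `E`-edge ends inside the finite set `U` and `|U| ≤ T`, then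
whatever is reachable from `u` is reachable in at most `T` steps (the reachable set grows at every
round until it stabilises, and it lives in `insert u U`). [folklore] -/
theorem stepLE_of_reflTransGen {U : Finset V} {T : ℕ} (hU : ∀ w v, E w v → v ∈ U) (hT : U.card ≤ T)
    {u v : V} (h : Relation.ReflTransGen E u v) : StepLE E T u v := by
  obtain ⟨n, hn⟩ := exists_stepLE_of_reflTransGen E h
  -- the reachable sets live inside `insert u U`
  have hsub : ∀ k, reachSet E k u ⊆ insert u U := by
    intro k
    induction k with
    | zero =>
      intro v hv
      rw [mem_reachSet, stepLE_zero] at hv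
      subst hv; exact mem_insert_self _ _
    | succ k ih =>
      intro v hv
      rcases mem_reachSet_succ E |>.1 hv with hv | ⟨w, _, hwv⟩
      · exact ih hv
      · exact mem_insert_of_mem (hU w v hwv)
  -- by step `T` the set has stabilised
  have hstab : ∃ k ≤ T, reachSet E (k + 1) u = reachSet E k u := by
    rcases card_reachSet_ge E u (T + 1) with hbig | ⟨k, hk, hs⟩
    · exfalso
      have h1 := Finset.card_le_card (hsub (T + 1))
      have h2 := Finset.card_insert_le u U
      omega
    · exact ⟨k, Nat.lt_succ_iff.1 hk, hs⟩
  obtain ⟨k, hkT, hs⟩ := hstab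
  have hall : ∀ j, k ≤ j → reachSet E j u = reachSet E k u := by
    intro j hj
    obtain ⟨d, rfl⟩ := Nat.exists_eq_add_of_le hj
    exact reachSet_eq_of_stable E hs d
  -- `v` is reached at step `n`, hence at step `max n k`, hence at step `k ≤ T`
  have hv : v ∈ reachSet E k u := by
    rw [← hall (max n k) (le_max_right _ _)]
    exact reachSet_mono E (le_max_left _ _) u ((mem_reachSet E).2 hn)
  exact ((mem_reachSet E).1 hv).mono E hkT

end StepLE

/-! ### The gadget -/

variable {ι Λ : Type*} [DecidableEq ι] [DecidableEq Λ] (P : SymProg ι Λ)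
variable (V : Type*) [Fintype V] [DecidableEq V] (T : ℕ)

/-- **The reachability gadget** inside `P` over the vertex type `V` with `T` rounds: membership and
edge wires, guarded edge gates `e`, closure gates `r i` (`i ≤ T`) with their step gates `mid`,
and the equations they satisfy in `P`. [cite: AndersonDawar2016, §3 (fixed points by unrolling)] -/
structure Reach where
  /-- membership wire of a vertex -/
  mem : V → ι ⊕ Λ
  /-- edge wire -/
  edge : V → V → ι ⊕ Λ
  /-- guarded edge: both ends are members and the edge wire is on -/
  e : V → V → Λ
  /-- `mid i u w v`: `r i u w ∧ e w v` -/
  mid : Fin T → V → V → V → Λ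
  /-- `r i u v`: `u` is a member and `v` is reachable from `u` in at most `i` guarded steps -/
  r : Fin (T + 1) → V → V → Λ
  kind_e : ∀ u v, P.kind (e u v) = Kind.and
  srcs_e : ∀ u v, P.srcs (e u v) = {mem u, mem v, edge u v}
  kind_mid : ∀ i u w v, P.kind (mid i u w v) = Kind.and
  srcs_mid : ∀ i u w v, P.srcs (mid i u w v) = {Sum.inr (r i.castSucc u w), Sum.inr (e w v)}
  kind_r_zero : ∀ u v, P.kind (r 0 u v) = if u = v then Kind.and else Kind.or
  srcs_r_zero : ∀ u v, P.srcs (r 0 u v) = if u = v then {mem u} else ∅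
  kind_r_succ : ∀ (i : Fin T) u v, P.kind (r i.succ u v) = Kind.or
  srcs_r_succ : ∀ (i : Fin T) u v, P.srcs (r i.succ u v) =
    insert (Sum.inr (r i.castSucc u v)) (univ.image fun w => Sum.inr (mid i u w v))

namespace Reach

variable {P V T} (R : P.Reach V T) (x : ι → Bool)

/-- The membership predicate on input `x`. [folklore] -/
def Mem (u : V) : Prop := wval x (P.sem x) (R.mem u) = true

/-- The guarded edge relation on input `x`. [folklore] -/
def Ex (u v : V) : Prop := R.Mem x u ∧ R.Mem x v ∧ wval x (P.sem x) (R.edge u v) = true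

/-- `e`. [folklore] -/
theorem sem_e (u v : V) : P.sem x (R.e u v) = true ↔ R.Ex x u v := by
  rw [P.sem_and (R.kind_e u v), R.srcs_e]
  simp only [mem_insert, mem_singleton, forall_eq_or_imp, forall_eq]
  rfl

/-- `mid`. [folklore] -/
theorem sem_mid (i : Fin T) (u w v : V) :
    P.sem x (R.mid i u w v) = true ↔ P.sem x (R.r i.castSucc u w) = true ∧ R.Ex x w v := by
  rw [P.sem_and (R.kind_mid i u w v), R.srcs_mid]
  simp only [mem_insert, mem_singleton, forall_eq_or_imp, forall_eq, wval_inr, sem_e]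

/-- `r 0`. [folklore] -/
theorem sem_r_zero (u v : V) : P.sem x (R.r 0 u v) = true ↔ R.Mem x u ∧ u = v := by
  by_cases huv : u = v
  · subst huv
    have hk : P.kind (R.r 0 u u) = Kind.and := by rw [R.kind_r_zero, if_pos rfl]
    rw [P.sem_and hk, R.srcs_r_zero, if_pos rfl]
    simp only [mem_singleton, forall_eq, and_true]
    rfl
  · have hk : P.kind (R.r 0 u v) = Kind.or := by rw [R.kind_r_zero, if_neg huv]
    rw [P.sem_or hk, R.srcs_r_zero, if_neg huv]
    simp [huv]

/-- **`r i u v` carries "member, and reachable in at most `i` guarded steps".** [folklore] -/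
theorem sem_r (i : Fin (T + 1)) (u v : V) :
    P.sem x (R.r i u v) = true ↔ R.Mem x u ∧ StepLE (R.Ex x) i u v := by
  obtain ⟨i, hi⟩ := i
  induction i generalizing v with
  | zero => exact R.sem_r_zero x u v
  | succ i ih =>
    have hi' : i < T := Nat.lt_of_succ_lt_succ hi
    have hcast : (⟨i + 1, hi⟩ : Fin (T + 1)) = (⟨i, hi'⟩ : Fin T).succ := rfl
    rw [hcast, P.sem_or (R.kind_r_succ _ u v), R.srcs_r_succ]
    simp only [mem_insert, mem_image, mem_univ, true_and, exists_eq_or_imp, exists_exists_eq_and,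
      wval_inr, sem_mid, Fin.castSucc_mk]
    have ih' : ∀ w, P.sem x (R.r ⟨i, Nat.lt_of_lt_of_le hi' (Nat.le_succ T)⟩ u w) = true ↔
        R.Mem x u ∧ StepLE (R.Ex x) i u w := fun w => ih w _
    simp only [ih', show ((⟨i, hi'⟩ : Fin T).succ : ℕ) = i + 1 from rfl, stepLE_succ]
    constructor
    · rintro (⟨hm, hs⟩ | ⟨w, ⟨hm, hs⟩, he⟩)
      · exact ⟨hm, Or.inl hs⟩
      · exact ⟨hm, Or.inr ⟨w, hs, he⟩⟩
    · rintro ⟨hm, hs | ⟨w, hs, he⟩⟩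
      · exact Or.inl ⟨hm, hs⟩
      · exact Or.inr ⟨w, ⟨hm, hs⟩, he⟩

/-- **The last round carries reachability**, as soon as there are at most `T` members.
[cite: AndersonDawar2016, §3 (fixed points by unrolling)] -/
theorem sem_r_last_iff [DecidablePred (R.Mem x)] (hT : (univ.filter fun w => R.Mem x w).card ≤ T)
    (u v : V) : P.sem x (R.r (Fin.last T) u v) = true ↔ R.Mem x u ∧ Relation.ReflTransGen (R.Ex x) u v := by
  rw [R.sem_r]
  refine and_congr_right fun _ => ⟨fun h => h.reflTransGen _, fun h => ?_⟩
  classical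
  exact stepLE_of_reflTransGen (R.Ex x) (U := univ.filter fun w => R.Mem x w)
    (fun w v hwv => mem_filter.2 ⟨mem_univ _, hwv.2.1⟩) hT h

end Reach

end SymProg

end Literature.Computability.Complexity
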